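import Literature.NumberTheory.LFunctions.Lagarias1999.Refutation
import HarnessLib

/-!
# Lagarias (1999), pp. 220–221 — the answer in the language of (1.14): `h_K(2) < ξ_K'(2)/ξ_K(2)`

[LagariasXiPositivity1999] defines `h_K(σ) = inf { Re ξ_K'/ξ_K(σ+it) : t ∈ ℝ }` ((1.14);
`Lagarias1999.hInf`) and his Theorem 1.2 concludes `h_K(σ) = ξ_K'(σ)/ξ_K(σ)` ((1.16)) for
`σ ≥ 1 + 9 n_K^{−1/3}`. `Lagarias1999.Refutation` answers the question of pp. 220–221 in the
pointwise form (`¬ InfAttainedOnRealAxis K 2` for `K = ℚ(√−163)`). This file records the same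
answer for the real infimum `hInf` itself: for an imaginary quadratic field with odd discriminant
the function `t ↦ Re ξ_K'/ξ_K(σ+it)` is bounded below on every line `σ > 1`
(`bddBelow_range_re_logDeriv_xi`: `Re ψ ≥ −γ` on `Re s ≥ 1` and `|ζ_K'/ζ_K(s)| ≤ Σ Λ_K(n) n^{−σ}`),
so `h_K(σ) ≤ Re ξ_K'/ξ_K(σ+it)` for every `t` (`hInf_le_re_logDeriv_xi`), and therefore
`h_K(2) < ξ_K'(2)/ξ_K(2)` for `K = ℚ(√−163)` (`hInf_two_lt`, `exists_hInf_two_lt`): (1.16) fails at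
`σ = 2 > 1`.
-/

open Complex NumberField
open scoped LSeries.notation ArithmeticFunction.vonMangoldt NumberTheorySymbols
open Literature.NumberTheory.QuadraticFields Literature.NumberTheory.QuadraticFields.Quadratic
open Literature.Analysis.SpecialFunctions.Complex

namespace Literature.NumberTheory.LFunctions.Lagarias1999

/-- `Re ψ(w) ≥ −γ` for `Re w ≥ 1`: every term `1/(k+1) − Re 1/(w+k)` of the Gauss series is
non-negative. [folklore] -/
private theorem neg_eulerMascheroni_le_re_digamma {w : ℂ} (hw : 1 ≤ w.re) :
    -Real.eulerMascheroniConstant ≤ (digamma w).re := by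
  have hs := hasSum_one_div_sub_one_div_digamma (w := w) (by linarith)
  have hre := Complex.hasSum_re hs
  have hval : (digamma w + Real.eulerMascheroniConstant).re =
      (digamma w).re + Real.eulerMascheroniConstant := by simp
  rw [hval] at hre
  have hnn : ∀ k : ℕ, 0 ≤ (1 / ((k : ℂ) + 1) - 1 / (w + k)).re := by
    intro k
    have h1 : (1 / ((k : ℂ) + 1)).re = 1 / ((k : ℝ) + 1) := by
      rw [show ((k : ℂ) + 1) = (((k : ℝ) + 1 : ℝ) : ℂ) by push_cast; ring, ← Complex.ofReal_one,
        ← Complex.ofReal_div, Complex.ofReal_re]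
    have h2 : (1 / (w + (k : ℂ))).re = (w.re + k) / ((w.re + k) ^ 2 + w.im ^ 2) := by
      rw [show (w + (k : ℂ)) = w + ((k : ℝ) : ℂ) by push_cast; ring, re_one_div_add_ofReal]
    rw [Complex.sub_re, h1, h2, sub_nonneg]
    have hk : (0 : ℝ) ≤ k := Nat.cast_nonneg k
    have hpos : 0 < w.re + k := by linarith
    rw [div_le_div_iff₀ (by positivity) (by positivity)]
    nlinarith [sq_nonneg w.im, sq_nonneg (w.re + k)]
  have := hre.nonneg hnn
  linarith

section field
variable {K : Type*} [Field K] [NumberField K]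

/-- For an imaginary quadratic field `K` with odd discriminant and `σ > 1`:
`Re ξ_K'/ξ_K(σ+it) ≥ log A_K − γ − Σ_n Λ_K(n) n^{−σ}` for all real `t`
(`Re 1/s, Re 1/(s−1) ≥ 0`, `Re ψ(s) ≥ −γ`, `|ζ_K'/ζ_K(s)| ≤ Σ Λ_K(n) n^{−σ}` by (2.13)–(2.15)).
[cite: LagariasXiPositivity1999, (2.13)–(2.15)] -/
theorem re_logDeriv_xi_ge [NeZero (discr K).natAbs] (h2 : Module.finrank ℚ K = 2)
    (hd : discr K < 0) (hodd : Odd (discr K)) {σ : ℝ} (hσ : 1 < σ) (t : ℝ) :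
    Real.log (lagariasA K) - Real.eulerMascheroniConstant
        - ∑' n : ℕ, lambdaK (discr K).natAbs n / (n : ℝ) ^ σ ≤
      (logDeriv (xi K) ((σ : ℂ) + t * I)).re := by
  set q := (discr K).natAbs with hq
  have hst : 1 < ((σ : ℂ) + t * I).re := by simpa using hσ
  rw [logDeriv_xi_eq h2 hd hodd hst]
  have hLs : L ↗Λ ((σ : ℂ) + t * I) + L (↗(jacobiChar q) * ↗Λ) ((σ : ℂ) + t * I) =
      LSeries (fun n => (lambdaK q n : ℂ)) ((σ : ℂ) + t * I) := LSeries_lambdaK_eq hst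
  have hbs : ‖LSeries (fun n => (lambdaK q n : ℂ)) ((σ : ℂ) + t * I)‖ ≤
      ∑' n : ℕ, lambdaK q n / (n : ℝ) ^ σ := by
    have := norm_LSeries_lambdaK_le (q := q) hst
    simpa using this
  have hres := Complex.re_le_norm (LSeries (fun n => (lambdaK q n : ℂ)) ((σ : ℂ) + t * I))
  have hψ : -Real.eulerMascheroniConstant ≤ (digamma ((σ : ℂ) + t * I)).re :=
    neg_eulerMascheroni_le_re_digamma (by simp; linarith)
  -- `Re 1/s ≥ 0`, `Re 1/(s-1) ≥ 0`
  have hz1 : ((σ : ℂ) + t * I) = ⟨σ, t⟩ := by apply Complex.ext <;> simp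
  have hz2 : ((σ : ℂ) + t * I - 1) = ⟨σ - 1, t⟩ := by apply Complex.ext <;> simp
  have ha : 0 ≤ (1 / ((σ : ℂ) + t * I)).re := by
    rw [hz1, one_div, Complex.inv_re, Complex.normSq_mk]
    apply div_nonneg (by simp; linarith)
    nlinarith [sq_nonneg t]
  have hb : 0 ≤ (1 / ((σ : ℂ) + t * I - 1)).re := by
    rw [hz2, one_div, Complex.inv_re, Complex.normSq_mk]
    apply div_nonneg (by simp; linarith)
    nlinarith [sq_nonneg t]
  have es : (1 / ((σ : ℂ) + t * I) + 1 / ((σ : ℂ) + t * I - 1) + (Real.log (lagariasA K) : ℂ) +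
      digamma ((σ : ℂ) + t * I) - L ↗Λ ((σ : ℂ) + t * I) -
      L (↗(jacobiChar q) * ↗Λ) ((σ : ℂ) + t * I)).re =
      (1 / ((σ : ℂ) + t * I)).re + (1 / ((σ : ℂ) + t * I - 1)).re + Real.log (lagariasA K) +
        (digamma ((σ : ℂ) + t * I)).re -
        (LSeries (fun n => (lambdaK q n : ℂ)) ((σ : ℂ) + t * I)).re := by
    rw [show (1 / ((σ : ℂ) + t * I) + 1 / ((σ : ℂ) + t * I - 1) + (Real.log (lagariasA K) : ℂ) +
      digamma ((σ : ℂ) + t * I) - L ↗Λ ((σ : ℂ) + t * I) -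
      L (↗(jacobiChar q) * ↗Λ) ((σ : ℂ) + t * I)) =
      1 / ((σ : ℂ) + t * I) + 1 / ((σ : ℂ) + t * I - 1) + (Real.log (lagariasA K) : ℂ) +
      digamma ((σ : ℂ) + t * I) -
      (L ↗Λ ((σ : ℂ) + t * I) + L (↗(jacobiChar q) * ↗Λ) ((σ : ℂ) + t * I)) by ring, hLs]
    simp only [Complex.sub_re, Complex.add_re, Complex.ofReal_re]
  rw [es]
  linarith

/-- Hence `t ↦ Re ξ_K'/ξ_K(σ+it)` is bounded below on every line `σ > 1` (for these `K`), so the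
infimum `h_K(σ)` of (1.14) is a genuine real infimum. [cite: LagariasXiPositivity1999, (1.14)] -/
theorem bddBelow_range_re_logDeriv_xi [NeZero (discr K).natAbs] (h2 : Module.finrank ℚ K = 2)
    (hd : discr K < 0) (hodd : Odd (discr K)) {σ : ℝ} (hσ : 1 < σ) :
    BddBelow (Set.range fun t : ℝ => (logDeriv (xi K) ((σ : ℂ) + t * I)).re) :=
  ⟨_, by rintro _ ⟨t, rfl⟩; exact re_logDeriv_xi_ge h2 hd hodd hσ t⟩

/-- `h_K(σ) ≤ Re ξ_K'/ξ_K(σ+it)` for every real `t` (`σ > 1`, `K` imaginary quadratic with odd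
discriminant). [cite: LagariasXiPositivity1999, (1.14)] -/
theorem hInf_le_re_logDeriv_xi [NeZero (discr K).natAbs] (h2 : Module.finrank ℚ K = 2)
    (hd : discr K < 0) (hodd : Odd (discr K)) {σ : ℝ} (hσ : 1 < σ) (t : ℝ) :
    hInf K σ ≤ (logDeriv (xi K) ((σ : ℂ) + t * I)).re :=
  ciInf_le (bddBelow_range_re_logDeriv_xi h2 hd hodd hσ) t

/-- For EVERY quadratic field of discriminant `−163`: `Re ξ_K'/ξ_K(2 + 7i/4) < ξ_K'/ξ_K(2)`
(the inequality behind `exists_not_infAttainedOnRealAxis`, stated for all such `K`).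
[cite: LagariasXiPositivity1999, pp. 220–221] -/
theorem re_logDeriv_xi_lt_of_discr_eq (h2 : Module.finrank ℚ K = 2)
    (hK : NumberField.discr K = -163) :
    (logDeriv (xi K) ((2 : ℂ) + (7 / 4 : ℝ) * I)).re < (logDeriv (xi K) (2 : ℂ)).re := by
  have hdneg : NumberField.discr K < 0 := by rw [hK]; norm_num
  have hodd : Odd (NumberField.discr K) := by rw [hK]; decide
  have hq : (NumberField.discr K).natAbs = 163 := by rw [hK]; rfl
  haveI : NeZero (NumberField.discr K).natAbs := ⟨by rw [hq]; norm_num⟩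
  have hmain := re_logDeriv_xi_two_sub_ge h2 hdneg hodd (7 / 4 : ℝ)
  have hψ := re_digamma_sub_le (7 / 4 : ℝ) 100
  have hS := tsum_lambdaK_div_sq_le (q := (NumberField.discr K).natAbs) (N := 1001) (by norm_num)
  rw [hq] at hmain hS
  obtain ⟨c1, c2, c3⟩ := cert163_sound cert163_true
  have hz1 : ((2 : ℂ) + ((7 / 4 : ℝ) : ℂ) * I) = ⟨2, 7 / 4⟩ := by apply Complex.ext <;> simp
  have hz2 : ((1 : ℂ) + ((7 / 4 : ℝ) : ℂ) * I) = ⟨1, 7 / 4⟩ := by apply Complex.ext <;> simp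
  have ha : (1 / (2 + ((7 / 4 : ℝ) : ℂ) * I)).re = 32 / 113 := by
    rw [hz1, one_div, Complex.inv_re, Complex.normSq_mk]; norm_num
  have hb : (1 / (1 + ((7 / 4 : ℝ) : ℂ) * I)).re = 16 / 65 := by
    rw [hz2, one_div, Complex.inv_re, Complex.normSq_mk]; norm_num
  have e1 : ((1001 : ℕ) : ℝ) - 1 = 1000 := by norm_num
  rw [ha, hb] at hmain
  rw [e1] at hS
  generalize (∑ n ∈ Finset.range 1001, lambdaK 163 n / (n : ℝ) ^ 2) = S₁ at hS c1
  generalize (∑' n : ℕ, lambdaK 163 n / (n : ℝ) ^ 2) = S₂ at hmain hS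
  generalize (∑ k ∈ Finset.range 100, psiDropTerm (7 / 4) k) = S₃ at hψ c3
  linarith

/-- **(1.16) fails at `σ = 2`:** for every quadratic field `K` of discriminant `−163`,
`h_K(2) < ξ_K'(2)/ξ_K(2)` — the infimum (1.14) on the line `Re s = 2` lies strictly below the
value at the real point. [cite: LagariasXiPositivity1999, pp. 220–221] -/
theorem hInf_two_lt (h2 : Module.finrank ℚ K = 2) (hK : NumberField.discr K = -163) :
    hInf K 2 < (logDeriv (xi K) (2 : ℂ)).re := by
  have hdneg : NumberField.discr K < 0 := by rw [hK]; norm_num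
  have hodd : Odd (NumberField.discr K) := by rw [hK]; decide
  haveI : NeZero (NumberField.discr K).natAbs := ⟨by rw [hK]; decide⟩
  have hle := hInf_le_re_logDeriv_xi h2 hdneg hodd (σ := 2) (by norm_num) (7 / 4 : ℝ)
  simp only [Complex.ofReal_ofNat] at hle
  exact hle.trans_lt (re_logDeriv_xi_lt_of_discr_eq h2 hK)

end field

/-- **Answer to the question of pp. 220–221 in the language of (1.14):** there is a number field
`K` (namely `ℚ(√−163)`) with `h_K(2) < ξ_K'(2)/ξ_K(2)`, i.e. the infimum of `Re ξ_K'/ξ_K` on the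
line `Re s = 2 > 1` is not attained on the real axis. [cite: LagariasXiPositivity1999, pp. 220–221] -/
theorem exists_hInf_two_lt :
    ∃ (K : Type) (_ : Field K) (_ : NumberField K),
      NumberField.discr K = -163 ∧ hInf K 2 < (logDeriv (xi K) (2 : ℂ)).re := by
  have hp : Nat.Prime 163 := by norm_num
  have hsq : Squarefree (-163 : ℤ) := by
    rw [← Int.squarefree_natAbs]
    exact hp.prime.squarefree
  obtain ⟨K, _, _, h2, hd⟩ :=
    exists_numberField_discr_eq (D := -163) (Or.inl ⟨by norm_num, hsq, by norm_num⟩)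
  exact ⟨K, inferInstance, inferInstance, hd, hInf_two_lt h2 hd⟩

end Literature.NumberTheory.LFunctions.Lagarias1999
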